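import Literature.NumberTheory.Rogawski1990.ArchEndoscopicTwoBlockTestFunction   -- ★ (3A′) p841779: the 2-block test function `Θ₂` and the CENTRAL centre identifications (`γ_H = (ζ•1₂, ζ•1₁)`)
import HarnessLib

/-!
# The SEMIREGULAR centre `γ_H = (e₁•1₂, e₂)` of Prop. 8.2.1 (a) at `∞` in the 2-block frame of ★ (3A′): the socket hypotheses `γ_H.1 = e₁•1`, `(γ_H.2)₀₀ = e₂` read as torus points
# (Rogawski 1990 §8.2 Prop. 8.2.1 p. 118; Lemma 14.5.2 (b) p. 238)

Topic `NumberTheory/Rogawski1990`; namespace `Literature.NumberTheory.Rogawski1990`.  THEOREMS ONLY (no `def`, no instance, no notation, no axiom, no named fact, no `sorry`).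
Cell `pub/hodgecm-mathlib`, HCML Track B «K2-LIT», ENGINE E4 unit U6 `ArchLimitConstant` (crux H413 = `stmt-HodgeConjecture-24833`), sockets #9∕#11∕#13 of
`Cruxes/H413/Lines/K2_E4_SingularTransferKappaSignSigsArchLimitConstant.lean` (assembler K2E4-p09); author K2E4-p13 (g0), 2026-09-03 — brick (i) «semiregular CENTRE ADAPTERS» of the
dealer's cut (K2E4-plan 21:07:16Z ∕ K2-lead (R-13a) 21:12:38Z).

WHY.  ★ (3A′) §3 identifies the CENTRAL rational point `γ_H = (ζ•1₂, ζ•1₁)` of (S-c) in B-p12's frame: `cmRationalToArch_one_eq_symm_circleDiagonal_of_coe_eq_smul_one` (the `U(Φ₁)`-coordinate is the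
constant torus point `diag(σ_w ζ)`) and `congr_cmRationalToArch_two_eq_archDiagTorus_of_coe_eq_smul_one` (the 2-block is `t(w ↦ (σ_w ζ, σ_w ζ))`), both from the hypothesis shape
`((γ) : Matrix) = ζ • 1` and the unit-circle fact `‖σ_w ζ‖ = 1` read off the `U(Φ₁)`-component.  The U6 sockets (Prop. 8.2.1 (a): the SEMIREGULAR `γ₀` with characteristic polynomial
`(X − e₁)²(X − e₂)`, `e₁ ≠ e₂`) carry the point `γ_H = (γ_H.1, γ_H.2)` with the hypotheses `((γ_H.1) : Matrix (Fin 2) (Fin 2) L) = e₁ • 1` and `((γ_H.2) : Matrix (Fin 1) (Fin 1) L) 0 0 = e₂`: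
the 2-block centre angle is `σ_w e₁` (read off the `U(Φ₂)`-component, NOT the `U(Φ₁)` one) and the frozen `U(Φ₁)`-angle is `σ_w e₂ ≠ σ_w e₁`.  This file supplies exactly those readings,
so that the H-side descent ★ `ArchEndoscopicCentralDescentValue` §4 (general regularity predicate, p854840) is fed with `z_w = σ_w e₁`, `d_w = σ_w e₂`.

* §1 (private `Matrix.eq_smul_one_of_fin_one`: `M = M₀₀ • 1` on `Fin 1`) `coe_eq_smul_one_of_apply_zero_zero_eq` (the socket's `(γ_H.2)₀₀ = e₂` as `γ_H.2 = e₂ • 1`);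
* §2 `complexConj_mul_self_eq_one_of_coe_two_eq_smul_one` (`e₁•1₂ ∈ U(Φ₂)(L⁺) ⇒ ē₁ e₁ = 1`, entry `(0,1)` of the unitarity relation for the antidiagonal `Φ₂`),
  `norm_embedding_eq_one_of_coe_two_eq_smul_one` (`‖σ_w e₁‖ = 1`);
* §3 the centre in B-p12's frame: `cmRationalToArch_one_eq_symm_circleDiagonal_of_apply_zero_zero_eq` (`γ_H.2 ⊗ 1 = e⁻¹(w ↦ diag(σ_w e₂))`),
  `congr_cmRationalToArch_two_eq_archDiagTorus_of_coe_two_eq_smul_one` (`ψ(γ_H.1 ⊗ 1) = t(w ↦ (σ_w e₁, σ_w e₁))` for any congruence frame `(T, ψ, hψ)`),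
  `embedding_ne_of_ne` (`σ_w e₁ ≠ σ_w e₂` as points of `S¹` when `e₁ ≠ e₂`).
HONEST LABEL: HC_CM is proved only modulo the 7 printed citations (2 remaining named inputs: hLiu418 = stmt-HodgeConjecture-24832, h413 = stmt-HodgeConjecture-24833) until rung 0 closes;
this file is algebra over ★ (3A′) and pays no socket by itself.

## References
* [Rogawski1990] J. D. Rogawski, *Automorphic Representations of Unitary Groups in Three Variables*, Ann. of Math. Stud. 123 (1990), §8.2 Prop. 8.2.1 (a) p. 118; §14.5 Lemma 14.5.2 (b) p. 238;
  §4.9 p. 54.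
* [BorelJacquet1979] A. Borel, H. Jacquet, *Automorphic forms and automorphic representations*, PSPM 33.1 (1979), §4.1.
-/

set_option autoImplicit false

noncomputable section

open NumberField NumberField.InfinitePlace NumberField.mixedEmbedding Topology Filter Set Function
open scoped Matrix MatrixGroups Classical

/-! ## §1 `Fin 1` matrices are scalars -/

/-- A `1 × 1` matrix is the scalar matrix of its entry: `M = M₀₀ • 1`. [folklore] -/
private theorem Matrix.eq_smul_one_of_fin_one {R : Type*} [Semiring R] (M : Matrix (Fin 1) (Fin 1) R) : M = M 0 0 • (1 : Matrix (Fin 1) (Fin 1) R) := by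
  ext i j
  rw [Subsingleton.elim i 0, Subsingleton.elim j 0, Matrix.smul_apply, Matrix.one_apply_eq, smul_eq_mul, mul_one]

namespace Literature.NumberTheory.Rogawski1990

open Literature.NumberTheory.Automorphic Literature.NumberTheory.Automorphic.UnitaryGroup
open Literature.AlgebraicGeometry.ShimuraVarieties (unitaryGroup mem_unitaryGroup_iff)

variable {L : Type} [Field L] [NumberField L] [IsCMField L]

/-- **The socket's `U(Φ₁)`-hypothesis as a scalar**: `((γ_H.2) : Matrix (Fin 1) (Fin 1) L) 0 0 = e₂` gives `(γ_H.2) = e₂ • 1` — the shape ★ (3A′) §3 consumes.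
[cite: Rogawski1990, §8.2 Prop. 8.2.1 (a) p. 118] -/
theorem coe_eq_smul_one_of_apply_zero_zero_eq
    (γ₁ : (UnitaryGroup.cmDatum L 1 (Matrix.of fun i j : Fin 1 => if i.val + j.val + 1 = 1 then (1 : L) else 0)).Rational) {e : L}
    (h : (((γ₁ : unitaryGroup (cmConjRingHom L) (Matrix.of fun i j : Fin 1 => if i.val + j.val + 1 = 1 then (1 : L) else 0)).val : GL (Fin 1) L) :
      Matrix (Fin 1) (Fin 1) L) 0 0 = e) :
    (((γ₁ : unitaryGroup (cmConjRingHom L) (Matrix.of fun i j : Fin 1 => if i.val + j.val + 1 = 1 then (1 : L) else 0)).val : GL (Fin 1) L) :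
      Matrix (Fin 1) (Fin 1) L) = e • (1 : Matrix (Fin 1) (Fin 1) L) := by
  rw [← h]
  exact Matrix.eq_smul_one_of_fin_one _

/-! ## §2 A scalar of `U(Φ₂)(L⁺)` is a unit-circle number at every complex place -/

/-- **`e•1₂ ∈ U(Φ₂)(L⁺) ⇒ ē e = 1`**: entry `(0,1)` of the unitarity relation `ᵗ(c̄g) Φ₂ g = Φ₂` for `g = e•1` and the antidiagonal `Φ₂` (`(Φ₂)₀₁ = 1`).
[cite: Rogawski1990, §8.2 Prop. 8.2.1 (a) p. 118; §4.9 p. 54] -/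
theorem complexConj_mul_self_eq_one_of_coe_two_eq_smul_one
    (γ₂ : (UnitaryGroup.cmDatum L 2 (Matrix.of fun i j : Fin 2 => if i.val + j.val + 1 = 2 then (1 : L) else 0)).Rational) {e : L}
    (hγ₂ : (((γ₂ : unitaryGroup (cmConjRingHom L) (Matrix.of fun i j : Fin 2 => if i.val + j.val + 1 = 2 then (1 : L) else 0)).val : GL (Fin 2) L) :
      Matrix (Fin 2) (Fin 2) L) = e • (1 : Matrix (Fin 2) (Fin 2) L)) :
    (IsCMField.complexConj L e : L) * e = 1 := by
  have hmem := mem_unitaryGroup_iff.1 γ₂.2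
  rw [hγ₂] at hmem
  have h01 := congrFun (congrFun hmem 0) 1
  simp [Matrix.mul_apply, Matrix.smul_apply, Matrix.one_apply, Matrix.map_apply, cmConjRingHom_apply, Fin.sum_univ_two] at h01
  simpa [mul_comm] using h01

/-- The central 2-block angles `σ_w e ∈ S¹` of a unitary scalar `e•1₂ ∈ U(Φ₂)(L⁺)`. [cite: Rogawski1990, §8.2 Prop. 8.2.1 (a) p. 118] -/
theorem norm_embedding_eq_one_of_coe_two_eq_smul_one
    (γ₂ : (UnitaryGroup.cmDatum L 2 (Matrix.of fun i j : Fin 2 => if i.val + j.val + 1 = 2 then (1 : L) else 0)).Rational) {e : L}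
    (hγ₂ : (((γ₂ : unitaryGroup (cmConjRingHom L) (Matrix.of fun i j : Fin 2 => if i.val + j.val + 1 = 2 then (1 : L) else 0)).val : GL (Fin 2) L) :
      Matrix (Fin 2) (Fin 2) L) = e • (1 : Matrix (Fin 2) (Fin 2) L)) (w : {w : InfinitePlace L // IsComplex w}) :
    ‖w.1.embedding e‖ = 1 :=
  norm_embedding_eq_one_of_complexConj_mul_self L e (complexConj_mul_self_eq_one_of_coe_two_eq_smul_one γ₂ hγ₂) w

omit [NumberField L] [IsCMField L] in
/-- Distinct elements of `L` have distinct images under a complex embedding, as points of `S¹` (the semiregular guard `e₁ ≠ e₂` ⇒ `σ_w e₁ ≠ σ_w e₂`: the frozen `U(Φ₁)`-angle avoids the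
central 2-block angle). [cite: Rogawski1990, §8.2 Prop. 8.2.1 (a) p. 118] -/
theorem embedding_ne_of_ne {e₁ e₂ : L} (h : e₁ ≠ e₂) (w : {w : InfinitePlace L // IsComplex w})
    (h₁ : ‖w.1.embedding e₁‖ = 1) (h₂ : ‖w.1.embedding e₂‖ = 1) :
    (⟨w.1.embedding e₁, mem_sphere_zero_iff_norm.mpr h₁⟩ : Circle) ≠ ⟨w.1.embedding e₂, mem_sphere_zero_iff_norm.mpr h₂⟩ := by
  intro hc
  have hv : w.1.embedding e₁ = w.1.embedding e₂ := congrArg (fun c : Circle => (c : ℂ)) hc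
  exact h (w.1.embedding.injective hv)

/-! ## §3 The semiregular centre in B-p12's frame -/

/-- **THE `U(Φ₁)`-COMPONENT OF THE SEMIREGULAR CENTRE**: under the socket hypothesis `(γ_H.2)₀₀ = e₂`, `γ_H.2 ⊗ 1 = e⁻¹(w ↦ diag(σ_w e₂))` in `U(Φ₁)(L ⊗ ℝ)` — the frozen coordinate `δ` of
the 2-block test function `Θ₂` of ★ (3A′) (★ `cmRationalToArch_one_eq_symm_circleDiagonal_of_coe_eq_smul_one` after §1). [cite: Rogawski1990, §8.2 Prop. 8.2.1 (a) p. 118; §14.5 p. 238]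
[cite: BorelJacquet1979, §4.1] -/
theorem cmRationalToArch_one_eq_symm_circleDiagonal_of_apply_zero_zero_eq
    (γ₁ : (UnitaryGroup.cmDatum L 1 (Matrix.of fun i j : Fin 1 => if i.val + j.val + 1 = 1 then (1 : L) else 0)).Rational) {e : L}
    (h : (((γ₁ : unitaryGroup (cmConjRingHom L) (Matrix.of fun i j : Fin 1 => if i.val + j.val + 1 = 1 then (1 : L) else 0)).val : GL (Fin 1) L) :
      Matrix (Fin 1) (Fin 1) L) 0 0 = e) :
    cmRationalToArch L 1 (Matrix.of fun i j : Fin 1 => if i.val + j.val + 1 = 1 then (1 : L) else 0) γ₁ =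
      (archPiEquivCM 1 L (Matrix.of fun i j : Fin 1 => if i.val + j.val + 1 = 1 then (1 : L) else 0)).symm fun w =>
        ⟨circleDiagonal 1 ![(⟨w.1.embedding e, mem_sphere_zero_iff_norm.mpr
            (norm_embedding_eq_one_of_coe_eq_smul_one γ₁ (coe_eq_smul_one_of_apply_zero_zero_eq γ₁ h) w)⟩ : Circle)],
          circleDiagonal_mem_archLocal_antidiagOne L w _⟩ :=
  cmRationalToArch_one_eq_symm_circleDiagonal_of_coe_eq_smul_one γ₁ (coe_eq_smul_one_of_apply_zero_zero_eq γ₁ h)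

variable {α : Fin 2 → L} (T : GL (Fin 2) (mixedSpace L))
  (ψ : UnitaryGroup.arch (↥(maximalRealSubfield L)) L (IsCMField.complexConj L) 2 (Matrix.of fun i j : Fin 2 => if i.val + j.val + 1 = 2 then (1 : L) else 0) ≃ₜ*
    UnitaryGroup.arch (↥(maximalRealSubfield L)) L (IsCMField.complexConj L) 2 (Matrix.diagonal α))
  (hψ : ∀ x, ((ψ x : UnitaryGroup.arch (↥(maximalRealSubfield L)) L (IsCMField.complexConj L) 2 (Matrix.diagonal α)) : GL (Fin 2) (mixedSpace L)) =
    T * (x : GL (Fin 2) (mixedSpace L)) * T⁻¹)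

include hψ in
/-- **THE 2-BLOCK OF THE SEMIREGULAR CENTRE IS THE CONSTANT TORUS POINT `(σ_w e₁, σ_w e₁)_w`**: for `γ_H.1 = e₁•1₂ ∈ U(Φ₂)(L⁺)`, `ψ(γ_H.1 ⊗ 1) = t(w ↦ (σ_w e₁, σ_w e₁))` in any congruence
frame `(T, ψ, hψ)` — ★ `congr_cmRationalToArch_two_eq_archDiagTorus_of_coe_eq_smul_one` with the unit-circle fact read off the `U(Φ₂)`-component itself (§2).  With ★ (3A′)
`exists_contDiff_twoBlock` this reads `Θ₂(centre) = aH(γ_H.1 ⊗ 1, γ_H.2 ⊗ 1) = aH(γ_H ⊗ 1)`, the value sockets #9∕#11∕#13 speak about.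
[cite: Rogawski1990, §8.2 Prop. 8.2.1 (a) p. 118; §14.5 Lemma 14.5.2 (b) p. 238] [cite: BorelJacquet1979, §4.1] -/
theorem congr_cmRationalToArch_two_eq_archDiagTorus_of_coe_two_eq_smul_one
    (γ₂ : (UnitaryGroup.cmDatum L 2 (Matrix.of fun i j : Fin 2 => if i.val + j.val + 1 = 2 then (1 : L) else 0)).Rational) {e : L}
    (hγ₂ : (((γ₂ : unitaryGroup (cmConjRingHom L) (Matrix.of fun i j : Fin 2 => if i.val + j.val + 1 = 2 then (1 : L) else 0)).val : GL (Fin 2) L) :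
      Matrix (Fin 2) (Fin 2) L) = e • (1 : Matrix (Fin 2) (Fin 2) L)) :
    ψ (cmRationalToArch L 2 (Matrix.of fun i j : Fin 2 => if i.val + j.val + 1 = 2 then (1 : L) else 0) γ₂) =
      archDiagTorus L 2 α (fun w _ => ⟨w.1.embedding e, mem_sphere_zero_iff_norm.mpr (norm_embedding_eq_one_of_coe_two_eq_smul_one γ₂ hγ₂ w)⟩) :=
  congr_cmRationalToArch_two_eq_archDiagTorus_of_coe_eq_smul_one T ψ hψ γ₂ hγ₂ (norm_embedding_eq_one_of_coe_two_eq_smul_one γ₂ hγ₂)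

end Literature.NumberTheory.Rogawski1990

end
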